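import Mathlib.Algebra.Group.Subgroup.Basic
import Mathlib.Tactic.Group
import HarnessLib

/-!
# Involutions in a coset `Γ·τ₀` up to `Γ`-conjugacy ↔ `H¹(⟨τ₀⟩, Γ)` (Goresky–Tai 2017, Proposition 47)

Goresky–Tai, *Real structures on ordinary abelian varieties*, arXiv:1701.07742, Appendix §20.1 «Nonabelian cohomology»,
p0046, print (verbatim):

> «Let `R` be a commutative ring with `1`. … the involution `τ₀` of `Rⁿ × Rⁿ` is defined by `τ₀(x, y) = (−x, y)`.
> Let `⟨τ₀⟩ = {1, τ₀} ≅ ℤ/(2)` denote the group generated by the involution `τ₀`.  For `g ∈ Sp(2n, R)` let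
> `g̃ = τ₀gτ₀⁻¹`.  This defines an action of the group `⟨τ₀⟩` on `Sp(2n, R)`.  Let `Γ ⊂ Sp_{2n}(R)` be a subgroup
> that is preserved by this action (that is, `Γ̃ = Γ`).  Recall that a 1-cocycle for this action is a mapping
> `f : ⟨τ₀⟩ → Γ` such that `f(1) = I` and `f(τ₀) = g` where `gg̃ = I`.  We may write `f = f_g` since the mapping
> `f` is determined by the element `g`.  Then two cocycles `f_g, f_{g′}` are cohomologous if there exists `h ∈ Γ`
> such that `g′ = h⁻¹gh̃` or equivalently, such that `g′ = h̃gh⁻¹`.  The set of cohomology classes is denoted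
> `H¹(⟨τ₀⟩, Γ)`.  If `τ ∈ GSp_{2n}(R)` is another involution (meaning that `τ² = I`) with multiplier equal to `−1`
> then `g = ττ₀` defines a cocycle since `gg̃ = 1`.  One easily checks the following.
> **Proposition 47.** Let `Γ ⊆ Sp_{2n}(R)` be a subgroup that is normalized by `τ₀`.  The mapping `τ ↦ ττ₀`
> determines a one to one correspondence between the set of `Γ`-conjugacy classes of involutions (i.e. elements
> of order `2`), `τ ∈ Γ.τ₀` and the cohomology set `H¹(⟨τ₀⟩, Γ)`.»

## What is formalized (the «one easily checks», as pure group theory)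

Only the group structure is used, so we work in an arbitrary group `G` (GT: `G = GSp_{2n}(R)` ⊃ `Sp_{2n}(R) ⊇ Γ`),
with an element `t ∈ G` with `t² = 1` (GT: `τ₀`), the twist `g̃ = tgt⁻¹`, and a subgroup `Γ ≤ G` normalised by `t`.
Cocycles are the `g ∈ Γ` with `g·g̃ = 1`; `g ∼ g′` («cohomologous») iff `g′ = h⁻¹gh̃` for some `h ∈ Γ`.  No quotient
types are introduced (theorems only): the correspondence is spelled out as

* `mul_twist_eq_one_iff_mul_self_eq_one` — «`g = ττ₀` defines a cocycle since `gg̃ = 1`»: for `τ = γt`,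
  `(γt)² = 1 ⟺ γγ̃ = 1`; `cocycle_of_involution` (`τ² = 1`, `τ ∈ Γt` ⟹ `ττ₀ ∈ Γ` is a cocycle — note `τ₀⁻¹ = τ₀`,
  so GT's `ττ₀` is our `τt⁻¹ = τt`);
* `cohomologous_iff_cohomologous'` — «`g′ = h⁻¹gh̃` or equivalently `g′ = h̃gh⁻¹`»;
* `exists_conj_eq_iff_cohomologous` — WELL-DEFINED AND INJECTIVE on classes: two involutions `τ, τ′ ∈ Γt` are
  `Γ`-conjugate iff `ττ₀`, `τ′τ₀` are cohomologous;
* `involution_of_cocycle` — SURJECTIVE: every cocycle `g` is `ττ₀` for the involution `τ = gt ∈ Γt`;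
* ★ `involutions_modConj_equiv_H1` — the three facts bundled (Proposition 47).

## References

* [GoreskyTai2017RealStructuresOrdinary] M. Goresky, Y.-S. Tai, *Real structures on ordinary abelian varieties*,
  arXiv:1701.07742 (2017), Appendix §20.1, Proposition 47.
-/

namespace Literature.GroupTheory

namespace InvolutionCosetH1

variable {G : Type*} [Group G]

/-- The algebra behind «`g = ττ₀` defines a cocycle since `gg̃ = 1`»: with `t² = 1` and `τ = γt`,
`τ² = 1 ⟺ γ·(tγt⁻¹) = 1`. [cite: GoreskyTai2017RealStructuresOrdinary, App. §20.1 (before Proposition 47)] -/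
theorem mul_twist_eq_one_iff_mul_self_eq_one {t : G} (ht : t * t = 1) (γ : G) :
    γ * (t * γ * t⁻¹) = 1 ↔ (γ * t) * (γ * t) = 1 := by
  have ht' : t⁻¹ = t := inv_eq_of_mul_eq_one_right ht
  rw [ht']
  constructor <;> intro h <;> simpa only [mul_assoc] using h

/-- For `τ` with `τt⁻¹ ∈ Γ` (i.e. `τ ∈ Γt`) and `τ² = 1`: `g = τt⁻¹` (`= ττ₀`, as `τ₀⁻¹ = τ₀`) lies in `Γ` and is a
cocycle, `g·(tgt⁻¹) = 1`. [cite: GoreskyTai2017RealStructuresOrdinary, App. §20.1 Proposition 47] -/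
theorem cocycle_of_involution {t : G} (ht : t * t = 1) {τ : G} (hτ : τ * τ = 1) :
    (τ * t⁻¹) * (t * (τ * t⁻¹) * t⁻¹) = 1 := by
  rw [mul_twist_eq_one_iff_mul_self_eq_one ht (τ * t⁻¹), inv_mul_cancel_right, hτ]

/-- «Two cocycles `f_g, f_{g′}` are cohomologous if there exists `h ∈ Γ` such that `g′ = h⁻¹gh̃` or equivalently,
such that `g′ = h̃gh⁻¹`» — the equivalence of the two forms (`h ↦ (h̃)⁻¹`, using `t² = 1` and `tΓt⁻¹ ⊆ Γ`).
[cite: GoreskyTai2017RealStructuresOrdinary, App. §20.1 (before Proposition 47)] -/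
theorem cohomologous_iff_cohomologous' {t : G} (ht : t * t = 1) {Γ : Subgroup G}
    (hΓ : ∀ x ∈ Γ, t * x * t⁻¹ ∈ Γ) (g g' : G) :
    (∃ h ∈ Γ, g' = h⁻¹ * g * (t * h * t⁻¹)) ↔ ∃ h ∈ Γ, g' = (t * h * t⁻¹) * g * h⁻¹ := by
  have ht' : t⁻¹ = t := inv_eq_of_mul_eq_one_right ht
  have key : ∀ h : G, t * (t * h⁻¹ * t⁻¹) * t⁻¹ = h⁻¹ := fun h => by
    rw [ht']
    calc t * (t * h⁻¹ * t) * t = (t * t) * h⁻¹ * (t * t) := by simp only [mul_assoc]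
      _ = h⁻¹ := by rw [ht, one_mul, mul_one]
  constructor
  · rintro ⟨h, hh, rfl⟩
    refine ⟨t * h⁻¹ * t⁻¹, hΓ _ (Γ.inv_mem hh), ?_⟩
    rw [key h]
    simp only [mul_inv_rev, inv_inv, mul_assoc]
  · rintro ⟨h, hh, rfl⟩
    refine ⟨t * h⁻¹ * t⁻¹, hΓ _ (Γ.inv_mem hh), ?_⟩
    rw [key h]
    simp only [mul_inv_rev, inv_inv, mul_assoc]

/-- The conjugation identity: `h(γt)h⁻¹ = γ′t ⟺ γ′ = hγ(tht⁻¹)⁻¹` (any `h, γ, γ′, t`).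
[cite: GoreskyTai2017RealStructuresOrdinary, App. §20.1 Proposition 47 («one easily checks»)] -/
theorem conj_mul_eq_mul_iff (t h γ γ' : G) :
    h * (γ * t) * h⁻¹ = γ' * t ↔ γ' = h * γ * (t * h * t⁻¹)⁻¹ := by
  constructor
  · intro e
    have e' : γ' = h * (γ * t) * h⁻¹ * t⁻¹ := by rw [e, mul_inv_cancel_right]
    rw [e']
    group
  · intro e
    rw [e]
    group

/-- **Well-defined and injective on classes**: two involutions `τ, τ′` of the coset `Γt` are `Γ`-conjugate iff the
cocycles `τt⁻¹`, `τ′t⁻¹` (`= ττ₀`, `τ′τ₀`) are cohomologous, `τ′t⁻¹ = h⁻¹(τt⁻¹)(tht⁻¹)` for some `h ∈ Γ`.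
[cite: GoreskyTai2017RealStructuresOrdinary, App. §20.1 Proposition 47] -/
theorem exists_conj_eq_iff_cohomologous {t : G} {Γ : Subgroup G} (τ τ' : G) :
    (∃ h ∈ Γ, h * τ * h⁻¹ = τ') ↔ ∃ h ∈ Γ, τ' * t⁻¹ = h⁻¹ * (τ * t⁻¹) * (t * h * t⁻¹) := by
  constructor
  · rintro ⟨h, hh, e⟩
    refine ⟨h⁻¹, Γ.inv_mem hh, ?_⟩
    rw [inv_inv, ← e]
    group
  · rintro ⟨h, hh, e⟩
    refine ⟨h⁻¹, Γ.inv_mem hh, ?_⟩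
    have e' : τ' = h⁻¹ * (τ * t⁻¹) * (t * h * t⁻¹) * t := by rw [← e, inv_mul_cancel_right]
    rw [e', inv_inv]
    group

/-- **Surjective**: every cocycle `g ∈ Γ` (`g·(tgt⁻¹) = 1`) is `τt⁻¹` for the involution `τ = gt` of the coset `Γt`
(`(gt)² = 1`, `(gt)t⁻¹ = g`). [cite: GoreskyTai2017RealStructuresOrdinary, App. §20.1 Proposition 47] -/
theorem involution_of_cocycle {t : G} (ht : t * t = 1) {g : G} (hg : g * (t * g * t⁻¹) = 1) :
    (g * t) * (g * t) = 1 ∧ (g * t) * t⁻¹ = g :=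
  ⟨(mul_twist_eq_one_iff_mul_self_eq_one ht g).1 hg, mul_inv_cancel_right g t⟩

/-- **Goresky–Tai 2017, Proposition 47** («The mapping `τ ↦ ττ₀` determines a one to one correspondence between
the set of `Γ`-conjugacy classes of involutions `τ ∈ Γ.τ₀` and the cohomology set `H¹(⟨τ₀⟩, Γ)`»), for a group
`G`, `t ∈ G` with `t² = 1` and a subgroup `Γ` normalised by `t`; with `g̃ = tgt⁻¹`, cocycles `{g ∈ Γ | gg̃ = 1}` and
`g ∼ g′ ⟺ ∃ h ∈ Γ, g′ = h⁻¹gh̃`: (1) for every involution `τ ∈ Γt`, `τt⁻¹ ∈ Γ` is a cocycle; (2) two such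
involutions are `Γ`-conjugate iff their cocycles are cohomologous; (3) every cocycle arises from an involution of
`Γt`.  (Here `ττ₀` is written `τt⁻¹`; `t⁻¹ = t`.) [cite: GoreskyTai2017RealStructuresOrdinary, App. §20.1 Proposition 47] -/
theorem involutions_modConj_equiv_H1 {t : G} (ht : t * t = 1) (Γ : Subgroup G)
    (hΓ : ∀ x ∈ Γ, t * x * t⁻¹ ∈ Γ) :
    (∀ τ : G, τ * t⁻¹ ∈ Γ → τ * τ = 1 →
        τ * t⁻¹ ∈ Γ ∧ (τ * t⁻¹) * (t * (τ * t⁻¹) * t⁻¹) = 1) ∧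
    (∀ τ τ' : G, (∃ h ∈ Γ, h * τ * h⁻¹ = τ') ↔
        ∃ h ∈ Γ, τ' * t⁻¹ = h⁻¹ * (τ * t⁻¹) * (t * h * t⁻¹)) ∧
    (∀ g ∈ Γ, g * (t * g * t⁻¹) = 1 →
        ∃ τ : G, τ * t⁻¹ ∈ Γ ∧ τ * τ = 1 ∧ τ * t⁻¹ = g) ∧
    (∀ g g' : G, (∃ h ∈ Γ, g' = h⁻¹ * g * (t * h * t⁻¹)) ↔ ∃ h ∈ Γ, g' = (t * h * t⁻¹) * g * h⁻¹) := by
  refine ⟨fun τ hτΓ hτ => ⟨hτΓ, cocycle_of_involution ht hτ⟩, fun τ τ' => exists_conj_eq_iff_cohomologous τ τ',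
    fun g hg hgc => ?_, fun g g' => cohomologous_iff_cohomologous' ht hΓ g g'⟩
  obtain ⟨h1, h2⟩ := involution_of_cocycle ht hgc
  exact ⟨g * t, by rwa [h2], h1, h2⟩

end InvolutionCosetH1

end Literature.GroupTheory
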